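import Summits.CriticalPhenomena.PercolationContinuityZ3.Theorems.PercNearOneGluingNoHeavyQuantLSCoreLMGCellsJ
import Summits.CriticalPhenomena.PercolationContinuityZ3.Theorems.PercNearOneGluingNoHeavyQuantLSCoreMMGIneqA
import Mathlib.Tactic.FieldSimp
import Mathlib.Tactic.Ring
import Mathlib.Tactic.Linarith
import Mathlib.Tactic.Positivity
import HarnessLib

/-!
# QUANT lane R8, T-DEC, binder (II) `ConvClosedTResidue`: LS-CORE, pattern LMG — the breakpoint inequalities in CLOSED FORM (part I)

builds on p205010 (kernel theorem, internal audit signed; external expert review pending)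

Support file (`--supports stmt-CriticalPhenomena-4575`), QUANT lane seat prim-quant-census-1 (gen 22), rung R8 of
`run/shared/lean/prim/quant/LADDER.md`.  Memo `run/shared/lean/prim/quant/prim-quant-census-1/LSCORE-G22.md` §9–§10.  Theorems only,
standard axioms, no sorries.

Pattern LMG of the six-cell light-slice law (`2(m+l) < T ≤ 2(m+l′)`: the cell `m+l` is a third low; it is pre-routed into the head cell `p+h`
— as much as fits at its usage, the rest to the giant — and the two row-`p` lows then run the two-low greedy of `…QuantTwoLowGreedy` on the
residual capacities, mids `m+l′` then `p+h`).  In the scale-free coordinates of `…QuantLSCoreMMGCells*` (`x, r, t, d, w`; `A = r + d`,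
`B = A + 2t`, deficit of `m+l` = `B − 2w`, span of `(m+l, p+h)` = `1 + t − w`) each lemma below is ONE breakpoint inequality of that greedy
(`kG`: at the giant; `kB`: at the head cell; `G0`: the residual pool is nonnegative) on ONE cell (pre-routing pair heavy/light `H/L`, fits or
saturates `f/s`, letters of the cross pairs `(p+l′,m+l′)`, `(p+l′,p+h)`, `(p+l,p+h)`), in closed form — masses `(1−γ)(1−x)λ, (1−γ)(1−x)λ′,
(1−γ)x | γ(1−x)λ, γ(1−x)λ′, γx` with `γ = x² + (1−x)d/w`, `λ, λ′` the tail weights, efficiencies `span/deficit − 1` (heavy) or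
`span/((1−x)deficit + x²span) − 1` (light) — derived from the polynomial certificate of the same name in `…QuantLSCoreLMGCells*` by clearing the
(positive) denominators.  The inequalities are stated WITHOUT the breakpoint premises (they hold on the whole cell, as in pattern MMG).

[this work].  Nothing here is cited as a published result.  The gluing rows served [cite: KozmaNitzan2024, Conjecture 3 (p. 15)];
product measure [cite: Grimmett1999, §1.3 p. 10].
-/

namespace Summit.CriticalPhenomena.PercolationContinuityZ3.Theorems

namespace Quant

namespace LawDec

namespace LSCoreLMG

set_option maxHeartbeats 8000000 in
set_option maxRecDepth 8000 in
set_option linter.unusedSimpArgs false in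
/-- **breakpoint inequality of cell `LMG_kG3w_3PLf_H_H`** in closed form (memo §10). [this work] -/
theorem ineq_kG3w_3PLf_H_H (x r t d w : ℝ) (hx0 : 0 < x) (hx1 : x < 1) (hr0 : 0 ≤ r) (hrx : r < x) (ht : 0 < t) (hw0 : 0 < w) (hw1 : w ≤ 1) (hd0 : 0 ≤ d) (hdx : d < x * w) (hre : 0 < r - x + t * (2 - x)) (hre1 : 0 < 1 - t - r) (hM1 : 2 * w < r + d + 2 * t) (_hM2 : r + d ≤ 2 * w) (b3 : r + d + 2 * t - 2 * w < x * (1 + t - w)) (_b3c : r + d + 2 * t - 2 * w < 1 + t - w) (_hfit : ((x ^ 2 + (1 - x) * d / w) * (1 - x) * ((x - r) * (1 - t - r) / (t * (2 - x ^ 2 - (1 - x) * r) - x * (x - r)))) ≤ ((1 - (x ^ 2 + (1 - x) * d / w)) * x) * (((1 + t - w) - ((1 - x) * (r + d + 2 * t - 2 * w) + x ^ 2 * (1 + t - w))) / ((1 - x) * (r + d + 2 * t - 2 * w) + x ^ 2 * (1 + t - w)))) (b22a : x * w ≤ r + d) (b22b : r + d < w) (b2Pa : x ≤ r + d) (_b2Pb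 : r + d < 1) (_hpre : ((x ^ 2 + (1 - x) * d / w) * (1 - x) * ((1 + x - r) * (r - x + t * (2 - x)) / (t * (2 - x ^ 2 - (1 - x) * r) - x * (x - r)))) * (w / (r + d) - 1) + (((1 - (x ^ 2 + (1 - x) * d / w)) * x) - ((x ^ 2 + (1 - x) * d / w) * (1 - x) * ((x - r) * (1 - t - r) / (t * (2 - x ^ 2 - (1 - x) * r) - x * (x - r)))) / (((1 + t - w) - ((1 - x) * (r + d + 2 * t - 2 * w) + x ^ 2 * (1 + t - w))) / ((1 - x) * (r + d + 2 * t - 2 * w) + x ^ 2 * (1 + t - w)))) * (1 / (r + d) - 1) ≤ ((1 - (x ^ 2 + (1 - x) * d / w)) * (1 - x) * ((1 + x - r) * (r - x + t * (2 - x)) / (t * (2 - x ^ 2 - (1 - x) * r) - x * (x - r))))) :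
    0 ≤ ((x ^ 2 + (1 - x) * d / w) * (1 - x)) + (((1 - (x ^ 2 + (1 - x) * d / w)) * x) - ((x ^ 2 + (1 - x) * d / w) * (1 - x) * ((x - r) * (1 - t - r) / (t * (2 - x ^ 2 - (1 - x) * r) - x * (x - r)))) / ((1 - x) / x)) * (1 / (r + d) - 1) + ((x ^ 2 + (1 - x) * d / w) * (1 - x) * ((1 + x - r) * (r - x + t * (2 - x)) / (t * (2 - x ^ 2 - (1 - x) * r) - x * (x - r)))) * (w / (r + d) - 1) - ((1 - (x ^ 2 + (1 - x) * d / w)) * (1 - x) * ((x - r) * (1 - t - r) / (t * (2 - x ^ 2 - (1 - x) * r) - x * (x - r)))) - ((1 - (x ^ 2 + (1 - x) * d / w)) * (1 - x) * ((1 + x - r) * (r - x + t * (2 - x)) / (t * (2 - x ^ 2 - (1 - x) * r) - x * (x - r)))) := by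
  have hdx' : d < x * w := hdx
  have hD : 0 < t * (2 - x ^ 2 - (1 - x) * r) - x * (x - r) := LSCoreMMG.D_pos x r t hx0 hx1 hr0 hrx hre
  have hg0 : 0 ≤ (x ^ 2 + (1 - x) * d / w) := by positivity
  have hlam : 0 ≤ ((x - r) * (1 - t - r) / (t * (2 - x ^ 2 - (1 - x) * r) - x * (x - r))) := div_nonneg (mul_nonneg (by linarith) (by linarith)) hD.le
  have hDv0' : (t * (2 - x ^ 2 - (1 - x) * r) - x * (x - r)) ≠ 0 := ne_of_gt hD
  have hwne : w ≠ 0 := hw0.ne'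
  have hxne : x ≠ 0 := hx0.ne'
  have hx1ne : (1:ℝ) - x ≠ 0 := by linarith
  have hB0 : r + d + 2 * t ≠ 0 := by linarith
  have hG0 : (1 - x) * (r + d) + x ^ 2 ≠ 0 := by positivity
  have hG1 : (1 - x) * (r + d) + x ^ 2 * w ≠ 0 := by positivity
  have hB3 : r + d + 2 * t - 2 * w ≠ 0 := by linarith
  have hG3 : (1 - x) * (r + d + 2 * t - 2 * w) + x ^ 2 * (1 + t - w) ≠ 0 := by nlinarith [mul_pos hx0 hx0, mul_pos (sub_pos.2 hx1) (show (0:ℝ) < r + d + 2 * t - 2 * w by linarith), sq_nonneg x, mul_nonneg (mul_pos hx0 hx0).le (show (0:ℝ) ≤ 1 + t - w by linarith)]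
  have hc3 : (1 + t - w) - (r + d + 2 * t - 2 * w) ≠ 0 := by linarith
  have hc3' : (1 + t - w) - ((1 - x) * (r + d + 2 * t - 2 * w) + x ^ 2 * (1 + t - w)) ≠ 0 := by nlinarith [mul_pos hx0 (sub_pos.2 hx1), mul_pos hx0 (show (0:ℝ) < (1 + t - w) - (r + d + 2 * t - 2 * w) by linarith), mul_pos hx0 ht, mul_pos hx0 hw0]
  have hA0 : r + d ≠ 0 := by nlinarith [mul_pos hx0 hw0, mul_pos hx0 ht]
  have hK : (1 - (r + d)) ≠ 0 := by linarith
  have hK2 : (w - (r + d)) ≠ 0 := by linarith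


  have hN := lcell_kG3w_3PLf_H_H x r t d w (show 0 ≤ x by linarith) (show 0 ≤ -x + 1 by linarith) (show 0 ≤ r by linarith) (show 0 ≤ -r + x by linarith) (show 0 ≤ t by linarith) (show 0 ≤ w by linarith) (show 0 ≤ -w + 1 by linarith) (show 0 ≤ d by linarith) (show 0 ≤ x * w - d by nlinarith [hD, mul_pos hx0 hw0, mul_pos hx0 ht, mul_pos hx0 (sub_pos.2 hx1), mul_pos (sub_pos.2 hx1) hw0, mul_pos hx0 hx0, mul_pos (mul_pos hx0 hx0) hw0, mul_nonneg (sub_pos.2 hx1).le (sub_pos.2 hdx').le, mul_pos (sub_pos.2 hx1) ht]) (show 0 ≤ -x * t + 2 * t + r - x by nlinarith [hD, mul_pos hx0 hw0, mul_pos hx0 ht, mul_pos hx0 (sub_pos.2 hx1), mul_pos (sub_pos.2 hx1) hw0, mul_pos hx0 hx0, mul_pos (mul_pos hx0 hx0) hw0, mul_nonneg (sub_pos.2 hx1).le (sub_pos.2 hdx').le, mul_pos (sub_pos.2 hx1) ht]) (show 0 ≤ -t - r + 1 by linarith) (show 0 ≤ -2 * w + d + 2 * t + r by linarith) (show 0 ≤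 2 * w - d - r by linarith) (show 0 ≤ d + r - x by linarith) (show 0 ≤ -d - r + 1 by linarith) (show 0 ≤ w - d - r by linarith)
  
  have p0 : 0 < (r + d) := by linarith
  have p1 : 0 < (w) := by linarith
  have p2 : 0 < (t * (2 - x ^ 2 - (1 - x) * r) - x * (x - r)) := hD
  set N : ℝ := -x ^ 4 * r * t * w ^ 2 + x ^ 5 * t * w ^ 2 + 3 * x ^ 3 * r * t * w ^ 2 + 2 * x ^ 3 * r * t * d * w + x ^ 3 * r ^ 2 * w ^ 2 + x ^ 3 * r ^ 2 * t * w - 2 * x ^ 4 * t * w ^ 2 - 2 * x ^ 4 * t * d * w - 2 * x ^ 4 * r * w ^ 2 - 2 * x ^ 4 * r * t * w + x ^ 5 * w ^ 2 + x ^ 5 * t * w - 2 * x ^ 2 * r * t * w ^ 2 - 4 * x ^ 2 * r * t * d * w - x ^ 2 * r * t * d ^ 2 - x ^ 2 * r ^ 2 * w ^ 2 - x ^ 2 * r ^ 2 * t * d + x ^ 2 * r ^ 3 * w - x ^ 3 * t * w ^ 2 + 2 * x ^ 3 * t * d * w + x ^ 3 * t * d ^ 2 + x ^ 3 * r * w ^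 2 + 2 * x ^ 3 * r * d * w - x ^ 3 * r * t * w + 2 * x ^ 3 * r * t * d - x ^ 3 * r ^ 2 * w - 2 * x ^ 4 * d * w + x ^ 4 * t * w - x ^ 4 * t * d - x ^ 4 * r * w + x ^ 5 * w + 4 * x * r * t * d * w + x * r * t * d ^ 2 + 2 * x * r ^ 2 * d * w - x * r ^ 2 * d ^ 2 - x * r ^ 2 * t * w + x * r ^ 2 * t * d - x * r ^ 3 * d + 2 * x ^ 2 * t * w ^ 2 + 2 * x ^ 2 * t * d * w + x ^ 2 * r * w ^ 2 - 4 * x ^ 2 * r * d * w + 4 * x ^ 2 * r * t * w - x ^ 2 * r * t * d - x ^ 2 * r ^ 2 * w + x ^ 2 * r ^ 2 * d - x ^ 3 * w ^ 2 + 2 * x ^ 3 * d * w + x ^ 3 * d ^ 2 - 3 * x ^ 3 * t * w + 2 * x ^ 3 * r * w + x ^ 3 * r * d - x ^ 4 * w - x ^ 4 * d - r * t * d * w - r ^ 2 * d * w + r ^ 2 * d ^ 2 + r ^ 2 * t * w + r ^ 3 * d - 3 * x * t * d * w - 3 * x * t * d ^ 2 - x * r * d * w + x * r * d ^ 2 -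 x * r * t * w - 3 * x * r * t * d - x * r ^ 2 * w + 2 * x ^ 2 * d * w - 2 * x ^ 2 * d ^ 2 + 3 * x ^ 2 * t * d + 2 * x ^ 2 * r * w - 3 * x ^ 2 * r * d - x ^ 3 * w + 2 * x ^ 3 * d + 2 * t * d ^ 2 + r * d * w - r * d ^ 2 - 2 * r * t * w + 2 * r * t * d - r ^ 2 * d - x * d * w + x * d ^ 2 + 2 * x * t * w - 2 * x * t * d + 2 * x * r * d - x ^ 2 * d with hNdef
  have key : ((x ^ 2 + (1 - x) * d / w) * (1 - x)) + (((1 - (x ^ 2 + (1 - x) * d / w)) * x) - ((x ^ 2 + (1 - x) * d / w) * (1 - x) * ((x - r) * (1 - t - r) / (t * (2 - x ^ 2 - (1 - x) * r) - x * (x - r)))) / ((1 - x) / x)) * (1 / (r + d) - 1) + ((x ^ 2 + (1 - x) * d / w) * (1 - x) * ((1 + x - r) * (r - x + t * (2 - x)) / (t * (2 - x ^ 2 - (1 - x) * r) - x * (x - r)))) * (w / (r + d) - 1) - ((1 - (x ^ 2 + (1 - x) * d / w)) * (1 - x) * ((x - r) * (1 - t - r) / (t * (2 - x ^ 2 - (1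 - x) * r) - x * (x - r)))) - ((1 - (x ^ 2 + (1 - x) * d / w)) * (1 - x) * ((1 + x - r) * (r - x + t * (2 - x)) / (t * (2 - x ^ 2 - (1 - x) * r) - x * (x - r))))
      = N / ((r + d) * (w) * (t * (2 - x ^ 2 - (1 - x) * r) - x * (x - r))) := by
    set Dv : ℝ := t * (2 - x ^ 2 - (1 - x) * r) - x * (x - r) with hDv
    have hDv0 : Dv ≠ 0 := ne_of_gt hD
    have hB0 : r + d + 2 * t ≠ 0 := by linarith
    have hG0 : (1 - x) * (r + d) + x ^ 2 ≠ 0 := by positivity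
    have hG1 : (1 - x) * (r + d) + x ^ 2 * w ≠ 0 := by positivity
    have hB3 : r + d + 2 * t - 2 * w ≠ 0 := by linarith
    have hG3 : (1 - x) * (r + d + 2 * t - 2 * w) + x ^ 2 * (1 + t - w) ≠ 0 := by nlinarith [mul_pos hx0 hx0, mul_pos (sub_pos.2 hx1) (show (0:ℝ) < r + d + 2 * t - 2 * w by linarith), sq_nonneg x, mul_nonneg (mul_pos hx0 hx0).le (show (0:ℝ) ≤ 1 + t - w by linarith)]
    have hc3 : (1 + t - w) - (r + d + 2 * t - 2 * w) ≠ 0 := by linarith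
    have hc3' : (1 + t - w) - ((1 - x) * (r + d + 2 * t - 2 * w) + x ^ 2 * (1 + t - w)) ≠ 0 := by nlinarith [mul_pos hx0 (sub_pos.2 hx1), mul_pos hx0 (show (0:ℝ) < (1 + t - w) - (r + d + 2 * t - 2 * w) by linarith), mul_pos hx0 ht, mul_pos hx0 hw0]
    have hA0 : r + d ≠ 0 := by nlinarith [mul_pos hx0 hw0, mul_pos hx0 ht]
    have hK : (1 - (r + d)) ≠ 0 := by linarith
    have hK2 : (w - (r + d)) ≠ 0 := by linarith
    have hne0 := (p0).ne'
    have hne1 := (p1).ne'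
    have hne2 := (p2).ne'
    have hw' : w ≠ 0 := hw0.ne'
    have hx1' : (1 : ℝ) - x ≠ 0 := by linarith
    have hx1'' : -x + 1 ≠ 0 := by linarith
    set At0 : ℝ := (r - x + t * (2 - x)) with hAt0
    set At1 : ℝ := (1 + x - r) with hAt1
    set At2 : ℝ := (1 - t - r) with hAt2
    set At3 : ℝ := (r + d) with hAt3
    set At4 : ℝ := (x - r) with hAt4
    set At5 : ℝ := (1 - x) with hAt5
    field_simp
    simp only [hNdef, hDv, hAt0, hAt1, hAt2, hAt3, hAt4, hAt5]
    ring
  rw [key]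
  exact div_nonneg hN (mul_pos (mul_pos p0 p1) p2).le

end LSCoreLMG

end LawDec

end Quant

end Summit.CriticalPhenomena.PercolationContinuityZ3.Theorems
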